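import Mathlib
import HarnessLib
import Summits.RiemannHypothesis.RiemannHypothesis.Theorems.IntegerScrewDefs
import Summits.RiemannHypothesis.RiemannHypothesis.Theorems.IntegerScrewNestedSylvester
import Summits.RiemannHypothesis.RiemannHypothesis.Theorems.IntegerScrewPivotCriterion

/-!
# Route `IntegerScrew` — the algebraic core of the finite-exception inertia calculus

Helper file for the A6-PIVOT theory track (HOME/pivot/PIVOT-LAW.md §11, «the ladder in a
finite-exception world»), supporting item stmt-RiemannHypothesis-15756 (`IntegerScrewPSD`).

By the unconditional zero expansion of the screw quadratic form
(`IntegerScrewLandau.hasSum_screwForm`: `xᵀ S_M x = Σ_ρ m(ρ)·(−P_x(ρ−½)P_x(½−ρ))/(ρ−½)²`), every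
zero ON the critical line contributes a non-negative square `m(ρ)|P_x(iγ)|²/γ²`, while the four
members `{½ ± η ± iγ₀}` of an OFF-LINE quadruple contribute together a real quadratic form of the
shape `Re(c · ℓ(x) · ℓ′(x))` with `ℓ = P_x(s)`, `ℓ′ = P_x(−s)` complex-valued real-linear functionals;
writing `ℓ = ℓ₁ + iℓ₂`, `cℓ′ = ℓ₃ + iℓ₄` this is `ℓ₁(x)ℓ₃(x) − ℓ₂(x)ℓ₄(x)`. The theorems below are the
linear algebra that turns this shape into the INERTIA BOUND of PIVOT-LAW §11 Lemma 1 / Theorem 3(i):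
a non-negative form plus `q` forms `ℓ₁ℓ₃ − ℓ₂ℓ₄` is non-negative on a subspace of codimension at most
`2q` (`exists_submodule_nonneg_of_quadrupleForms`), hence every subspace on which the total form is
negative definite has dimension at most `2q` (`finrank_le_two_mul_of_negDef`) — «at most two negative
squares per off-line quadruple», the count of E. Bombieri, *Remarks on Weil's quadratic functional
in the theory of prime numbers I*, Rend. Lincei (9) 11 (2000), Thms 8–9 (tree: named facts
`Bombieri2000.theorem8/9`), here in the elementary form needed for finite Gram matrices; plus the
pivot-sign rule of PIVOT-LAW §11 Theorem 3(iv) (`screwPivot_pos_iff_even_iff_even`: the sign of a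
pivot is the parity change of the negative eigenvalue count) and the two tail statements of the T3
barrier question (`eventual_screwPivot_pos_of_riemannHypothesis`,
`riemannHypothesis_of_base_and_eventual_screwPivot_pos`). Nothing in this file bears on the truth of
RH: the zeta-specific content (the splitting of the zero sum of `screwMatrix n` under a
finite-exception hypothesis) enters only as the HYPOTHESIS `hS` of the `screwMatrix` corollary and is
established on paper in PIVOT-LAW §11 / HOME/pivot/FINITE-EXCEPTION-LADDER.md.
-/

noncomputable section

-- D-0017: `Summit.<S>.<S>.…` is the designed namespace of a single-problem summit.
set_option linter.dupNamespace false

namespace Summit.RiemannHypothesis.RiemannHypothesis.Theorems.IntegerScrew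

open Module

variable {V : Type*} [AddCommGroup V] [Module ℝ V] [FiniteDimensional ℝ V]

/-- The kernel of a real linear functional has codimension at most one. [folklore] -/
theorem finrank_le_finrank_ker_add_one (f : V →ₗ[ℝ] ℝ) :
    finrank ℝ V ≤ finrank ℝ (LinearMap.ker f) + 1 := by
  have h := LinearMap.finrank_range_add_finrank_ker f
  have hr : finrank ℝ (LinearMap.range f) ≤ 1 := by
    calc finrank ℝ (LinearMap.range f) ≤ finrank ℝ ℝ := Submodule.finrank_le _
      _ = 1 := Module.finrank_self ℝ
  omega

/-- Codimension is subadditive under intersection: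
`finrank s + finrank t ≤ finrank (s ⊓ t) + finrank V`. [folklore] -/
theorem finrank_add_finrank_le_finrank_inf_add (s t : Submodule ℝ V) :
    finrank ℝ s + finrank ℝ t ≤ finrank ℝ ↥(s ⊓ t) + finrank ℝ V := by
  have h := Submodule.finrank_sup_add_finrank_inf_eq s t
  have h2 : finrank ℝ ↥(s ⊔ t) ≤ finrank ℝ V := Submodule.finrank_le _
  omega

/-- Codimension of a finite intersection: if each `K j` has codimension at most `c`, then
`⨅_{j ∈ s} K j` has codimension at most `c · #s`. [folklore] -/
theorem finrank_le_finrank_inf_add_mul {ι : Type*} (K : ι → Submodule ℝ V) (c : ℕ)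
    (hK : ∀ j, finrank ℝ V ≤ finrank ℝ (K j) + c) (s : Finset ι) :
    finrank ℝ V ≤ finrank ℝ ↥(s.inf K) + c * s.card := by
  classical
  induction s using Finset.induction_on with
  | empty =>
    rw [Finset.card_empty, Finset.inf_empty, finrank_top]
    simp
  | insert a s ha ih =>
    rw [Finset.inf_insert, Finset.card_insert_of_notMem ha]
    have h1 := hK a
    have h2 := finrank_add_finrank_le_finrank_inf_add (K a) (s.inf K)
    have h3 : c * (s.card + 1) = c * s.card + c := by ring
    omega

/-- **One off-line quadruple has at most two negative squares** (PIVOT-LAW §11 Lemma 1, algebraic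
core): for real linear functionals `ℓ₁, ℓ₂, ℓ₃, ℓ₄` the form `x ↦ ℓ₁(x)ℓ₃(x) − ℓ₂(x)ℓ₄(x)` is
non-negative on the subspace `ker(ℓ₁ − ℓ₃) ⊓ ker(ℓ₂ + ℓ₄)`, of codimension at most `2`, where it equals
`ℓ₁(x)² + ℓ₂(x)²`. [folklore] -/
theorem exists_submodule_nonneg_quadrupleForm (ℓ₁ ℓ₂ ℓ₃ ℓ₄ : V →ₗ[ℝ] ℝ) :
    ∃ W : Submodule ℝ V, finrank ℝ V ≤ finrank ℝ W + 2 ∧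
      ∀ x ∈ W, 0 ≤ ℓ₁ x * ℓ₃ x - ℓ₂ x * ℓ₄ x := by
  refine ⟨LinearMap.ker (ℓ₁ - ℓ₃) ⊓ LinearMap.ker (ℓ₂ + ℓ₄), ?_, ?_⟩
  · have h1 := finrank_le_finrank_ker_add_one (ℓ₁ - ℓ₃)
    have h2 := finrank_le_finrank_ker_add_one (ℓ₂ + ℓ₄)
    have h3 := finrank_add_finrank_le_finrank_inf_add
      (LinearMap.ker (ℓ₁ - ℓ₃)) (LinearMap.ker (ℓ₂ + ℓ₄))
    omega
  · intro x hx
    rw [Submodule.mem_inf, LinearMap.mem_ker, LinearMap.mem_ker, LinearMap.sub_apply,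
      LinearMap.add_apply] at hx
    obtain ⟨ha, hb⟩ := hx
    have e3 : ℓ₃ x = ℓ₁ x := by linarith
    have e4 : ℓ₄ x = -ℓ₂ x := by linarith
    rw [e3, e4]
    nlinarith [sq_nonneg (ℓ₁ x), sq_nonneg (ℓ₂ x)]

/-- **A non-negative form plus `q` quadruple forms is non-negative on a subspace of codimension at
most `2q`** (PIVOT-LAW §11 Theorem 3(i), algebraic core). Here `P` is any pointwise non-negative
function (in the application: the on-line Gram part of the screw form) and the `j`-th quadruple form
is `ℓ₁ j x · ℓ₃ j x − ℓ₂ j x · ℓ₄ j x`. [folklore] -/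
theorem exists_submodule_nonneg_of_quadrupleForms {q : ℕ} (P : V → ℝ) (hP : ∀ x, 0 ≤ P x)
    (ℓ₁ ℓ₂ ℓ₃ ℓ₄ : Fin q → (V →ₗ[ℝ] ℝ)) :
    ∃ W : Submodule ℝ V, finrank ℝ V ≤ finrank ℝ W + 2 * q ∧
      ∀ x ∈ W, 0 ≤ P x + ∑ j, (ℓ₁ j x * ℓ₃ j x - ℓ₂ j x * ℓ₄ j x) := by
  classical
  let K : Fin q → Submodule ℝ V := fun j =>
    LinearMap.ker (ℓ₁ j - ℓ₃ j) ⊓ LinearMap.ker (ℓ₂ j + ℓ₄ j)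
  have hK : ∀ j, finrank ℝ V ≤ finrank ℝ (K j) + 2 := by
    intro j
    have h1 := finrank_le_finrank_ker_add_one (ℓ₁ j - ℓ₃ j)
    have h2 := finrank_le_finrank_ker_add_one (ℓ₂ j + ℓ₄ j)
    have h3 := finrank_add_finrank_le_finrank_inf_add
      (LinearMap.ker (ℓ₁ j - ℓ₃ j)) (LinearMap.ker (ℓ₂ j + ℓ₄ j))
    show finrank ℝ V ≤ finrank ℝ ↥(LinearMap.ker (ℓ₁ j - ℓ₃ j) ⊓ LinearMap.ker (ℓ₂ j + ℓ₄ j)) + 2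
    omega
  refine ⟨(Finset.univ : Finset (Fin q)).inf K, ?_, ?_⟩
  · have h := finrank_le_finrank_inf_add_mul K 2 hK Finset.univ
    rw [Finset.card_univ, Fintype.card_fin] at h
    exact h
  · intro x hx
    have hterm : ∀ j, 0 ≤ ℓ₁ j x * ℓ₃ j x - ℓ₂ j x * ℓ₄ j x := by
      intro j
      have hxj : x ∈ K j := (Finset.inf_le (Finset.mem_univ j) : Finset.univ.inf K ≤ K j) hx
      have hxj' : x ∈ LinearMap.ker (ℓ₁ j - ℓ₃ j) ⊓ LinearMap.ker (ℓ₂ j + ℓ₄ j) := hxj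
      rw [Submodule.mem_inf, LinearMap.mem_ker, LinearMap.mem_ker, LinearMap.sub_apply,
        LinearMap.add_apply] at hxj'
      obtain ⟨ha, hb⟩ := hxj'
      have e3 : ℓ₃ j x = ℓ₁ j x := by linarith
      have e4 : ℓ₄ j x = -(ℓ₂ j x) := by linarith
      rw [e3, e4]
      nlinarith [sq_nonneg (ℓ₁ j x), sq_nonneg (ℓ₂ j x)]
    have hsum : 0 ≤ ∑ j, (ℓ₁ j x * ℓ₃ j x - ℓ₂ j x * ℓ₄ j x) :=
      Finset.sum_nonneg fun j _ => hterm j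
    linarith [hP x]

/-- **Negative index at most `2q`** (PIVOT-LAW §11 Theorem 3(i), algebraic core; «at most two
negative squares per off-line quadruple», cf. Bombieri 2000 Thms 8–9): if a form `P + Σ_{j<q}
(ℓ₁ʲℓ₃ʲ − ℓ₂ʲℓ₄ʲ)` with `P ≥ 0` pointwise is NEGATIVE DEFINITE on a subspace `N`, then
`finrank N ≤ 2q`. Applied to the screw Gram matrix `S_M` in a world with `q` off-line quadruples
(and to the span of its eigenvectors with negative — or, with the on-line part positive definite,
non-positive — eigenvalue) this is `n₋(S_M) ≤ 2q`. [folklore] -/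
theorem finrank_le_two_mul_of_negDef {q : ℕ} (P : V → ℝ) (hP : ∀ x, 0 ≤ P x)
    (ℓ₁ ℓ₂ ℓ₃ ℓ₄ : Fin q → (V →ₗ[ℝ] ℝ)) (N : Submodule ℝ V)
    (hN : ∀ x ∈ N, x ≠ 0 → P x + ∑ j, (ℓ₁ j x * ℓ₃ j x - ℓ₂ j x * ℓ₄ j x) < 0) :
    finrank ℝ N ≤ 2 * q := by
  obtain ⟨W, hW, hWpos⟩ := exists_submodule_nonneg_of_quadrupleForms P hP ℓ₁ ℓ₂ ℓ₃ ℓ₄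
  have hbot : N ⊓ W = ⊥ := by
    rw [Submodule.eq_bot_iff]
    intro x hx
    rw [Submodule.mem_inf] at hx
    by_contra hne
    have h1 := hN x hx.1 hne
    have h2 := hWpos x hx.2
    linarith
  have h := Submodule.finrank_sup_add_finrank_inf_eq N W
  rw [hbot, finrank_bot, add_zero] at h
  have h2 : finrank ℝ ↥(N ⊔ W) ≤ finrank ℝ V := Submodule.finrank_le _
  omega

/-- Matrix form of `finrank_le_two_mul_of_negDef` for `V = (Fin n → ℝ)` and a real matrix `S`
whose quadratic form splits as `xᵀSx = P(x) + Σ_j (ℓ₁ʲ(x)ℓ₃ʲ(x) − ℓ₂ʲ(x)ℓ₄ʲ(x))` with `P ≥ 0`: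
every subspace on which `xᵀSx < 0` for `x ≠ 0` has dimension at most `2q`. This is the shape in
which PIVOT-LAW §11 uses it for `S = screwMatrix (M − 1)` under a finite-exception hypothesis
(on-line zeros give `P`, each off-line quadruple one `j`). [folklore] -/
theorem finrank_le_two_mul_of_quadForm_neg {n q : ℕ} (S : Matrix (Fin n) (Fin n) ℝ)
    (P : (Fin n → ℝ) → ℝ) (hP : ∀ x, 0 ≤ P x) (ℓ₁ ℓ₂ ℓ₃ ℓ₄ : Fin q → ((Fin n → ℝ) →ₗ[ℝ] ℝ))
    (hS : ∀ x, dotProduct x (S.mulVec x) = P x + ∑ j, (ℓ₁ j x * ℓ₃ j x - ℓ₂ j x * ℓ₄ j x))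
    (N : Submodule ℝ (Fin n → ℝ)) (hN : ∀ x ∈ N, x ≠ 0 → dotProduct x (S.mulVec x) < 0) :
    finrank ℝ N ≤ 2 * q := by
  refine finrank_le_two_mul_of_negDef P hP ℓ₁ ℓ₂ ℓ₃ ℓ₄ N ?_
  intro x hx hne
  rw [← hS x]
  exact hN x hx hne

/-- The same for the SCREW GRAM MATRIX `S_{n+1} = screwMatrix n` of the route (`IntegerScrewDefs`):
IF its quadratic form splits as a pointwise non-negative part plus `q` quadruple forms
`ℓ₁ʲℓ₃ʲ − ℓ₂ʲℓ₄ʲ` (which is what the zero expansion gives in a world with `q` off-line quadruples of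
zeros, PIVOT-LAW §11 (0)–(1)), THEN every subspace on which the form is negative definite has
dimension ≤ `2q` — «n₋(S_M) ≤ 2q», PIVOT-LAW §11 Theorem 3(i). The hypothesis `hS` is the
finite-exception structure; nothing here asserts it. [folklore] -/
theorem screwMatrix_finrank_negDef_le {n q : ℕ} (P : (Fin n → ℝ) → ℝ) (hP : ∀ x, 0 ≤ P x)
    (ℓ₁ ℓ₂ ℓ₃ ℓ₄ : Fin q → ((Fin n → ℝ) →ₗ[ℝ] ℝ))
    (hS : ∀ x, dotProduct x ((screwMatrix n).mulVec x) =
      P x + ∑ j, (ℓ₁ j x * ℓ₃ j x - ℓ₂ j x * ℓ₄ j x))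
    (N : Submodule ℝ (Fin n → ℝ))
    (hN : ∀ x ∈ N, x ≠ 0 → dotProduct x ((screwMatrix n).mulVec x) < 0) :
    finrank ℝ N ≤ 2 * q :=
  finrank_le_two_mul_of_quadForm_neg (screwMatrix n) P hP ℓ₁ ℓ₂ ℓ₃ ℓ₄ hS N hN

/-! ### Pivot signs from the parity of the negative index (PIVOT-LAW §11 Theorem 3(iv)) -/

/-- The sign of a product of non-zero reals is the parity of the number of negative factors.
[folklore] -/
theorem prod_pos_iff_even_card_neg {ι : Type*} [DecidableEq ι] (s : Finset ι) (f : ι → ℝ)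
    (hf : ∀ i ∈ s, f i ≠ 0) :
    (0 < ∏ i ∈ s, f i) ↔ Even ((s.filter fun i => f i < 0).card) := by
  induction s using Finset.induction_on with
  | empty => simp
  | insert a s ha ih =>
    have hfa : f a ≠ 0 := hf a (Finset.mem_insert_self a s)
    have hfs : ∀ i ∈ s, f i ≠ 0 := fun i hi => hf i (Finset.mem_insert_of_mem hi)
    have hP : ∏ i ∈ s, f i ≠ 0 := Finset.prod_ne_zero_iff.mpr hfs
    rw [Finset.prod_insert ha, Finset.filter_insert]
    rcases lt_or_gt_of_ne hfa with hneg | hpos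
    · -- `f a < 0`: the sign flips and the count goes up by one
      rw [if_pos hneg, Finset.card_insert_of_notMem (fun h => ha (Finset.mem_filter.mp h).1),
        Nat.even_add_one, ← ih hfs]
      constructor
      · intro h hP'
        have : f a * ∏ i ∈ s, f i < 0 := mul_neg_of_neg_of_pos hneg hP'
        linarith
      · intro h
        have hPneg : ∏ i ∈ s, f i < 0 := lt_of_le_of_ne (not_lt.mp h) hP
        exact mul_pos_of_neg_of_neg hneg hPneg
    · -- `0 < f a`: nothing changes
      rw [if_neg (not_lt.mpr hpos.le), ← ih hfs]
      constructor
      · intro h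
        by_contra hP'
        have hPneg : ∏ i ∈ s, f i < 0 := lt_of_le_of_ne (not_lt.mp hP') hP
        have : f a * ∏ i ∈ s, f i < 0 := mul_neg_of_pos_of_neg hpos hPneg
        linarith
      · intro h
        exact mul_pos hpos h

/-- `det S_{n+1} > 0` iff the number of negative eigenvalues of `S_{n+1} = screwMatrix n` is even —
provided no eigenvalue vanishes (`S_{n+1}` nonsingular). [folklore] -/
theorem screwDet_pos_iff_even_card_neg (n : ℕ)
    (h0 : ∀ i, (screwMatrix_isHermitian n).eigenvalues i ≠ 0) :
    0 < screwDet n ↔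
      Even ((Finset.univ.filter fun i => (screwMatrix_isHermitian n).eigenvalues i < 0).card) := by
  have hdet : screwDet n = ∏ i, (screwMatrix_isHermitian n).eigenvalues i := by
    simpa [screwDet] using (screwMatrix_isHermitian n).det_eq_prod_eigenvalues
  rw [hdet]
  exact prod_pos_iff_even_card_neg Finset.univ _ fun i _ => h0 i

/-- **The sign of a pivot is the parity CHANGE of the negative index** (PIVOT-LAW §11 Theorem
3(iv), kernel form): if `S_{n+1} = screwMatrix n` and `S_{n+2} = screwMatrix (n+1)` are both
nonsingular (no zero eigenvalue), then the pivot `d_{n+2} = det S_{n+2}/det S_{n+1}` is positive iff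
the numbers of negative eigenvalues of `S_{n+1}` and `S_{n+2}` have the same parity. With Cauchy
interlacing (the negative index of the bordered matrix exceeds that of the corner block by at most one;
not formalised here) this says: `d_M < 0` exactly at the indices where the negative index increments,
so a world with `q` off-line quadruples has at most `2q` negative pivots. [folklore] -/
theorem screwPivot_pos_iff_even_iff_even (n : ℕ)
    (h0 : ∀ i, (screwMatrix_isHermitian n).eigenvalues i ≠ 0)
    (h1 : ∀ i, (screwMatrix_isHermitian (n + 1)).eigenvalues i ≠ 0) :
    0 < screwPivot (n + 2) ↔
      (Even ((Finset.univ.filter fun i => (screwMatrix_isHermitian (n + 1)).eigenvalues i < 0).card) ↔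
        Even ((Finset.univ.filter fun i => (screwMatrix_isHermitian n).eigenvalues i < 0).card)) := by
  rw [screwPivot_add_two, ← screwDet_pos_iff_even_card_neg n h0,
    ← screwDet_pos_iff_even_card_neg (n + 1) h1]
  have ha : screwDet (n + 1) ≠ 0 := by
    have hdet : screwDet (n + 1) = ∏ i, (screwMatrix_isHermitian (n + 1)).eigenvalues i := by
      simpa [screwDet] using (screwMatrix_isHermitian (n + 1)).det_eq_prod_eigenvalues
    rw [hdet]; exact Finset.prod_ne_zero_iff.mpr fun i _ => h1 i
  have hb : screwDet n ≠ 0 := by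
    have hdet : screwDet n = ∏ i, (screwMatrix_isHermitian n).eigenvalues i := by
      simpa [screwDet] using (screwMatrix_isHermitian n).det_eq_prod_eigenvalues
    rw [hdet]; exact Finset.prod_ne_zero_iff.mpr fun i _ => h0 i
  constructor
  · intro h
    rcases lt_or_gt_of_ne hb with hbneg | hbpos
    · have haneg : screwDet (n + 1) < 0 := by
        by_contra hc
        have hapos : 0 < screwDet (n + 1) := lt_of_le_of_ne (not_lt.mp hc) (Ne.symm ha)
        have : screwDet (n + 1) / screwDet n < 0 := div_neg_of_pos_of_neg hapos hbneg
        linarith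
      constructor
      · intro h'; linarith
      · intro h'; linarith
    · have hapos : 0 < screwDet (n + 1) := by
        by_contra hc
        have haneg : screwDet (n + 1) < 0 := lt_of_le_of_ne (not_lt.mp hc) ha
        have : screwDet (n + 1) / screwDet n < 0 := div_neg_of_neg_of_pos haneg hbpos
        linarith
      exact ⟨fun _ => hbpos, fun _ => hapos⟩
  · intro h
    rcases lt_or_gt_of_ne hb with hbneg | hbpos
    · have hna : ¬ 0 < screwDet (n + 1) := fun ha' => absurd (h.mp ha') (not_lt.mpr hbneg.le)
      have haneg : screwDet (n + 1) < 0 := lt_of_le_of_ne (not_lt.mp hna) ha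
      exact div_pos_of_neg_of_neg haneg hbneg
    · exact div_pos (h.mpr hbpos) hbpos

/-! ### The two tail statements of the T3 barrier question (PIVOT-LAW §11 (7)(b)) -/

/-- **RH ⟹ EVENTUAL POSITIVITY of the pivot ladder** («ETAIL»: `∃ M₀, ∀ M ≥ M₀, d_M > 0`), the
trivial direction. PIVOT-LAW §11 Theorem 4/4′ (paper) shows that ETAIL also follows from the mere
FINITENESS of the set of off-line zeros, which is why ETAIL — with an unspecified threshold — is not
an RH-equivalent target; that implication is not formalised here. [folklore] -/
theorem eventual_screwPivot_pos_of_riemannHypothesis (hRH : _root_.RiemannHypothesis) :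
    ∃ M₀ : ℕ, ∀ M : ℕ, M₀ ≤ M → 0 < screwPivot M :=
  ⟨2, fun M hM => (riemannHypothesis_iff_screwPivot_pos.mp hRH) M hM⟩

/-- **EVENTUAL POSITIVITY WITH AN EXPLICIT THRESHOLD plus the finite base below it IS RH**: if
`d_M > 0` for `2 ≤ M < M₀` (a finite, RH-free computation) and `d_M > 0` for all `M ≥ M₀`, then RH.
This is the precise sense in which the tail statement with an explicit `M₀` is RH-equivalent
«through the certified base» (PIVOT-LAW §11 (7)(b)); cf. `IntegerScrewTailCriterion` for the
packaged `M₀ = 5` form. [folklore] -/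
theorem riemannHypothesis_of_base_and_eventual_screwPivot_pos (M₀ : ℕ)
    (hbase : ∀ M : ℕ, 2 ≤ M → M < M₀ → 0 < screwPivot M)
    (htail : ∀ M : ℕ, M₀ ≤ M → 2 ≤ M → 0 < screwPivot M) :
    _root_.RiemannHypothesis := by
  rw [riemannHypothesis_iff_screwPivot_pos]
  intro M hM
  rcases lt_or_ge M M₀ with h | h
  · exact hbase M hM h
  · exact htail M h hM

end Summit.RiemannHypothesis.RiemannHypothesis.Theorems.IntegerScrew
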